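import Summits.CriticalPhenomena.PercolationContinuityZ3.Theorems.Transplant.SkelFrmQuasiBChoiceZoneKPx
import Summits.CriticalPhenomena.PercolationContinuityZ3.Theorems.Transplant.SkelFrmFromBParamsKitBump
import Summits.CriticalPhenomena.PercolationContinuityZ3.Theorems.Transplant.PlanarSkeletonFrmQuasiDefs
import Summits.CriticalPhenomena.PercolationContinuityZ3.Theorems.Transplant.SkelFrmQuasi1ChoiceDefs
import Summits.CriticalPhenomena.PercolationContinuityZ3.Theorems.Transplant.SkelFrmQuasiBChoiceDefs3
import Summits.CriticalPhenomena.PercolationContinuityZ3.Theorems.Transplant.SkelFrmQuasiBParamsLF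
import Summits.CriticalPhenomena.PercolationContinuityZ3.Theorems.Transplant.SkelFrmQuasi1SlotTypes
import HarnessLib

/-!
# GEN-Q PORT (WAVE-Q table v0.8 section 2, row G277, U-level L?; captain R-6/R-7 2026-08-27: carrier token swap `PlanarSkeletonFrmFrom ↦ PlanarSkeletonFrmQuasi`)
# of the tree module «Transplant/SkelFrmFromBParamsKitBump» (sha256 b0d1e99da730b49a…) onto the quasi-step carrier `PlanarSkeletonFrmQuasi` (p507026): «SkelFrmQuasiBParamsKitBump»

ORIGINAL TITLE: 

builds on p205010 (kernel theorem, internal audit signed; external expert review pending) — nothing in this file uses p205010; NOTHING is claimed about any open node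
((N3-b), the end state).  Lane `prim-bschramm`, seat `prim-hp-8` (gen 62; GEN-Q pen, family BChoiceRoot*/1Root*/BParamsKit·Bridge; tool = captain gen-1 g4's port_genq.py R-14 + p3-g30 T1/T2 + stmt-g33 --force-keep).  Helper file (`--supports stmt-CriticalPhenomena-4575 --as helper`).
PORT RULES (U-wave r1–r4 re-used, GEN-Q hunk classes of p3-g29 #6136): declaration order, names and proof texts are those of «SkelFrmFromBParamsKitBump», byte-identical except
(i) the carrier token `PlanarSkeletonFrmFrom ↦ PlanarSkeletonFrmQuasi` in binders, `namespace`/`end` lines and qualified names (module names `SkelFrmFrom… ↦ SkelFrmQuasi…`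
in imports of already-ported rows); (ii) `Φ.step ↦ Φ.qstep` with the called Steps lemma replaced by its `…Q`/`_q` twin and the cost `Φ.M` threaded (none in this file unless
listed below); (iii) `Φ.cyl_connected ↦ Φ.cyl_reach` readers (none unless listed); (iv) graph-ball radii / window floors ×`Φ.M` (none unless listed); r2 (U-wave rule re-used, applied by captain gen-1 g5 with p3-g30's inline_r2.py over hp-8 g62's staged text): section `variable` binders that bind the carrier are inlined into the kept headers (the gate's dedup otherwise reads a carrier-free header as a restatement of the FrmFrom twin — p537288).  Carrier-free
residents stay imported/exported from the original «SkelFrmBParamsKitBump» exactly as in the FrmFrom port.  Docstrings and citations are the original's.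

-/

noncomputable section

open scoped Classical

namespace Summit.CriticalPhenomena.PercolationContinuityZ3.Theorems.Transplant

open MeasureTheory Literature.Probability.Percolation Literature.Probability.LatticeModels SimpleGraph KNCells KNLevels
open Literature.Barriers.CriticalPhenomena (graphBall graphBall_mono)
open SkelConc (Consts)
open Skelφ.StepI (DataN DataNS OutNS)

/-! ## §1 The bumped record (K-1) -/

namespace Skelφ.StepI

variable {V : Type}

-- GEN-Q: carrier-free resident `Skelφ.StepI.DataNS.bumpR` lives in the FrmFrom module (same namespace) — not re-declared.

-- GEN-Q: carrier-free resident `Skelφ.StepI.DataNS.bumpR_Λ` lives in the FrmFrom module (same namespace) — not re-declared.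

-- GEN-Q: carrier-free resident `Skelφ.StepI.DataNS.bumpR_k` lives in the FrmFrom module (same namespace) — not re-declared.

-- GEN-Q: carrier-free resident `Skelφ.StepI.DataNS.bumpR_M₀` lives in the FrmFrom module (same namespace) — not re-declared.

-- GEN-Q: carrier-free resident `Skelφ.StepI.DataNS.bumpR_n₁` lives in the FrmFrom module (same namespace) — not re-declared.

-- GEN-Q: carrier-free resident `Skelφ.StepI.DataNS.bumpR_hgt` lives in the FrmFrom module (same namespace) — not re-declared.

-- GEN-Q: carrier-free resident `Skelφ.StepI.DataNS.bumpR_len` lives in the FrmFrom module (same namespace) — not re-declared.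

-- GEN-Q: carrier-free resident `Skelφ.StepI.DataNS.bumpR_spl` lives in the FrmFrom module (same namespace) — not re-declared.

-- GEN-Q: carrier-free resident `Skelφ.StepI.DataNS.bumpR_sM` lives in the FrmFrom module (same namespace) — not re-declared.

-- GEN-Q: carrier-free resident `Skelφ.StepI.DataNS.bumpR_sN` lives in the FrmFrom module (same namespace) — not re-declared.

-- GEN-Q: carrier-free resident `Skelφ.StepI.DataNS.bumpR_R` lives in the FrmFrom module (same namespace) — not re-declared.

-- GEN-Q: carrier-free resident `Skelφ.StepI.DataNS.bumpR_R_of_lt` lives in the FrmFrom module (same namespace) — not re-declared.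

-- GEN-Q: carrier-free resident `Skelφ.StepI.DataNS.bumpR_R_of_le` lives in the FrmFrom module (same namespace) — not re-declared.

-- GEN-Q: carrier-free resident `Skelφ.StepI.DataNS.le_bumpR_R` lives in the FrmFrom module (same namespace) — not re-declared.

-- GEN-Q: carrier-free resident `Skelφ.StepI.DataNS.bumpR_R_le` lives in the FrmFrom module (same namespace) — not re-declared.

-- GEN-Q: carrier-free resident `Skelφ.StepI.DataNS.bumpR_scale` lives in the FrmFrom module (same namespace) — not re-declared.

-- GEN-Q: carrier-free resident `Skelφ.StepI.DataNS.bumpR_zero` lives in the FrmFrom module (same namespace) — not re-declared.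

end Skelφ.StepI

namespace PlanarSkeletonFrmQuasi

/-! ## §2 The zone-scale data are invariant (K-1) -/

namespace Neg

variable {V : Type}

export PlanarSkeletonFrmFrom.Neg (Mu_bumpR)

export PlanarSkeletonFrmFrom.Neg (ρz_bumpR)

export PlanarSkeletonFrmFrom.Neg (nS_bumpR)

end Neg

/-! ## §3 The kit pair's widths are invariant, the kit radius is raised by `Dp` (K-1) -/

namespace NegB

namespace KS

open Neg

variable {V : Type}

export PlanarSkeletonFrmFrom.NegB.KS (MK_bumpR)

export PlanarSkeletonFrmFrom.NegB.KS (nKit_bumpR)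

export PlanarSkeletonFrmFrom.NegB.KS (hKit_bumpR)

export PlanarSkeletonFrmFrom.NegB.KS (ℓKit_bumpR)

export PlanarSkeletonFrmFrom.NegB.KS (vKit_bumpR)

export PlanarSkeletonFrmFrom.NegB.KS (Mu_lt_scaleKit)

export PlanarSkeletonFrmFrom.NegB.KS (RK_bumpR)

export PlanarSkeletonFrmFrom.NegB.KS (Rs_bumpR)

export PlanarSkeletonFrmFrom.NegB.KS (RK_add_le_Rs_bumpR)

export PlanarSkeletonFrmFrom.NegB.KS (Rs_bumpR_le)

export PlanarSkeletonFrmFrom.NegB.KS (Rs_le_Rs_bumpR)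

export PlanarSkeletonFrmFrom.NegB.KS (RgK_bumpR)

-- GEN-Q (R-2, captain 2026-08-27): `PlanarSkeletonFrmFrom.NegB.KS.cUA_bumpR` is not in the used cone of the node top — not ported.

export PlanarSkeletonFrmFrom.NegB.KS (RgK_bumpR_zero)

end KS

/-! ## §4 The junctions under `AtQNQ` (K-1 for the (C) column, K-2 for the (R) column) -/

open Neg

section Junction

variable {κ : Consts} {V : Type} [DecidableEq V] [Countable V] {G : SimpleGraph V} [G.LocallyFinite] {Φ : PlanarSkeletonFrmQuasi G} {t : V} {p : unitInterval}
  {hC : Φ.CylSubcritical p} {gv fv : Neg.FSlot} {Pv : PSlot} {Sv : SSlot} {cv : CSlot} {bv : BSlot} {O : OutNS V} {q : unitInterval} {D : ℕ}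

-- GEN-Q (R-2, captain 2026-08-27): `PlanarSkeletonFrmFrom.NegB.hΛRgK_bumpR_of_atQPx` is not in the used cone of the node top — not ported.

-- GEN-Q (R-2, captain 2026-08-27): `PlanarSkeletonFrmFrom.NegB.hΛRgKk_bumpR_of_atQPx` is not in the used cone of the node top — not ported.

/-- **(K-2) THE KIT INDEX IS BELOW ITS OWN KIT RADIUS** on the Step-I record: `mk ≤ KS.RK t O.merged mk` (`R = fatRadius ≥ id`, `scale ≥ n_kit > M_kit ≥ mk`);
so the raised index `mkP := RK mk + D` serves `RK mk + D ≤ RK mkP`. [folklore] -/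
theorem mk_le_RK_of_atQ {κ : Consts} {V : Type} [DecidableEq V] [Countable V] {G : SimpleGraph V} [G.LocallyFinite] {Φ : PlanarSkeletonFrmQuasi G} {t : V} {p : unitInterval} {hC : Φ.CylSubcritical p} {gv : Neg.FSlot} {fv : Neg.FSlot} {Pv : PSlot} {Sv : SSlot} {cv : CSlot} {bv : BSlot} {O : OutNS V} {q : unitInterval} (mk : ℕ) (hAt : (choiceAtQ3 κ Φ t p Pv gv fv Sv cv bv hC).AtQNQ O q) : mk ≤ KS.RK t O.merged mk := by
  obtain ⟨-, -, -, hReq, -⟩ := Skelφ.StepI.OutO.FactsO.seed hAt.1.factsO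
  have h1 := (KS.MK_facts O.merged mk).2.2.2
  have h2 := (KS.nKit_facts O.merged mk).2.1
  have h3 : KS.nKit O.merged mk ≤ O.merged.scale t (KS.MK O.merged mk) (KS.nKit O.merged mk) := le_max_left _ _
  have hReq' : ∀ n, O.merged.R n = Skelφ.fatRadius Φ.frame hC n := fun n => congrFun hReq n
  unfold KS.RK
  rw [hReq']
  exact le_trans (by omega) (h3.trans (Skelφ.le_fatRadius Φ.frame hC _))

/-- **(K-2) THE RAISED INDEX `mkP := RK mk + D`** clears `RK mk + D ≤ RK mkP`. [folklore] -/
theorem RK_add_le_RK_raise_of_atQ {κ : Consts} {V : Type} [DecidableEq V] [Countable V] {G : SimpleGraph V} [G.LocallyFinite] {Φ : PlanarSkeletonFrmQuasi G} {t : V} {p : unitInterval} {hC : Φ.CylSubcritical p} {gv : Neg.FSlot} {fv : Neg.FSlot} {Pv : PSlot} {Sv : SSlot} {cv : CSlot} {bv : BSlot} {O : OutNS V} {q : unitInterval} {D : ℕ} (mk : ℕ) (hAt : (choiceAtQ3 κ Φ t p Pv gv fv Sv cv bv hC).AtQNQ O q) :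
    KS.RK t O.merged mk + D ≤ KS.RK t O.merged (KS.RK t O.merged mk + D) :=
  mk_le_RK_of_atQ _ hAt

end Junction

end NegB

end PlanarSkeletonFrmQuasi

end Summit.CriticalPhenomena.PercolationContinuityZ3.Theorems.Transplant

end
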